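import Mathlib
import Summits.NavierStokesRegularity.NavierStokesRegularity.Theses.SubcriticalEnvelope
import HarnessLib

/-!
# `SubcriticalEnvelope.SubcriticalTailEnvelope` (stmt-NavierStokesRegularity-23973) — negative lemma
# modulo the existence of CRITICAL FRONTS among the sub-dissipatively perturbed trajectories

The crux quantifies over ALL `(K₁,0)`-pseudo-solutions of a table (`CascadeODESolutionOn T ε₀ α K₁ 0 0`):
with `K₂ = 0` the defect clauses force `E = ½X²`, and the energy inequality then says that the
perturbation of the exact motion is an arbitrary time- and mode-dependent DAMPING
`0 ≤ d_{i,n}(t) ≤ K₁(1+ε₀)^{2n}/√2` — the item's own "why it might fail" (adversarial sub-dissipative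
steering).  For the dyadic member `dyadicTable ∈ E₂(2)` a GATED damping schedule (damp the modes two
shells ahead of the front maximally while the current hop completes, then release) drives the front to
an exactly critical self-similar state `E_n(t_n) ≍ (1+ε₀)^{-n}` (numerical evidence attached to the
item: scale ratios `1.1, 1.25, 1.5`, `K₁ ∈ {10, 100}`; the critical scaling
`n ↦ n+1, a ↦ (1+ε₀)^{-1/2}a, t ↦ (1+ε₀)^{-2}t` is an exact symmetry of the damped class, and the hop
map has a stable fixed point where the loss per hop equals `1 − (1+ε₀)^{-1}`).

This file records the KILL CRITERION as a theorem: any family of pseudo-solutions of one E₂(R)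
table from one datum at one defect level on one window whose shell energies stay ABOVE a fixed multiple
of the critical weight `(1+ε₀)^{-n}` at every shell `n` (one trajectory per shell suffices) refutes
the crux — and such families at arbitrarily small `ε₀` refute it for that `R`.  The same family
refutes the HYPOTHESIS of `EnvelopeSmoothing` (stmt-24008) at that table and datum (so that crux is
vacuous there).  The hypothesis `hF` is the construction the tree cannot yet supply (rigorous gated
fronts of the damped Katz–Pavlović chain); nothing is asserted about it.

HONEST FRAMING: MODEL lattice ODEs only (Tao 2016 §4); nothing here concerns the Navier–Stokes
equations; these theorems settle nothing by themselves (conditional refutations, pure logic).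
-/

noncomputable section

set_option linter.dupNamespace false

namespace Summit.NavierStokesRegularity.NavierStokesRegularity.Theorems

namespace SubcriticalEnvelopeSubcriticalTailEnvelopeNegative

open Set Literature.Analysis.FluidPDE Literature.Analysis.FluidPDE.TaoCascade
open Summit.NavierStokesRegularity.NavierStokesRegularity.Theses.SubcriticalEnvelope

variable {m : ℕ}

/-- **No subcritical envelope constant over a family with critical fronts.**  If for some table,
datum, defect level `K₁`, window `[0,T]` and `c > 0` there is, for EVERY shell `n`, a
`(K₁,0)`-pseudo-solution on `[0,T]` whose shell-`n` energy reaches `c(1+ε₀)^{-n}` at some time of the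
window, then no constant `C` bounds the tail energies of all these pseudo-solutions by
`C(1+ε₀)^{-(1+η)n}`, whatever `η > 0`.  (Elementary: `c(1+ε₀)^{ηn} ≤ C` for all `n` is impossible.)
[cite: Tao2016AveragedNS, §4 Lemma 4.1 (4.5)–(4.11) (the pseudo-solution class); cell vocabulary] -/
theorem not_exists_envelope_const_of_criticalFronts {ε₀ η K₁ T c : ℝ} (hε₀ : 0 < ε₀) (hη : 0 < η)
    (hc : 0 < c) {α : Fin m → Fin m → Fin m → ℤ × ℤ × ℤ → ℝ} {X₀ : Fin m → ℝ}
    (hfam : ∀ n : ℕ, ∃ X E : Fin m → ℤ → ℝ → ℝ, CascadeODESolutionOn T ε₀ α K₁ 0 0 X₀ X E ∧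
      ∃ t ∈ Icc (0 : ℝ) T, c * (1 + ε₀) ^ (-(n : ℝ)) ≤ ∑ i, E i (n : ℤ) t) :
    ¬ ∃ C : ℝ, ∀ X E : Fin m → ℤ → ℝ → ℝ, CascadeODESolutionOn T ε₀ α K₁ 0 0 X₀ X E →
      ∀ n N : ℕ, n ≤ N → ∀ t ∈ Icc (0 : ℝ) T,
        ∑ k ∈ Finset.Icc n N, ∑ i, E i (k : ℤ) t ≤ C * (1 + ε₀) ^ (-((1 + η) * (n : ℝ))) := by
  rintro ⟨C, hC⟩
  have hb : 0 < 1 + ε₀ := by linarith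
  -- at every shell the lower and upper bounds combine to `c (1+ε₀)^{η n} ≤ C`
  have key : ∀ n : ℕ, c * ((1 + ε₀) ^ η) ^ n ≤ C := by
    intro n
    obtain ⟨X, E, hsol, t, ht, hlow⟩ := hfam n
    have hup := hC X E hsol n n le_rfl t ht
    rw [Finset.Icc_self, Finset.sum_singleton] at hup
    have h1 : c * (1 + ε₀) ^ (-(n : ℝ)) ≤ C * (1 + ε₀) ^ (-((1 + η) * (n : ℝ))) := hlow.trans hup
    have hpos : 0 < (1 + ε₀) ^ ((1 + η) * (n : ℝ)) := Real.rpow_pos_of_pos hb _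
    have h2 := mul_le_mul_of_nonneg_right h1 hpos.le
    rw [mul_assoc, mul_assoc, ← Real.rpow_add hb, ← Real.rpow_add hb,
      show -(n : ℝ) + (1 + η) * (n : ℝ) = η * (n : ℝ) by ring,
      show -((1 + η) * (n : ℝ)) + (1 + η) * (n : ℝ) = 0 by ring, Real.rpow_zero, mul_one,
      Real.rpow_mul hb.le, Real.rpow_natCast] at h2
    exact h2
  -- but `(1+ε₀)^η > 1`, so its powers are unbounded
  have hb1 : 1 < (1 + ε₀) ^ η := Real.one_lt_rpow (by linarith) hη
  obtain ⟨n, hn⟩ := pow_unbounded_of_one_lt (C / c) hb1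
  have h3 : C < c * ((1 + ε₀) ^ η) ^ n := by
    rw [div_lt_iff₀ hc] at hn
    linarith [mul_comm (((1 + ε₀) ^ η) ^ n) c]
  exact absurd (key n) (not_le.2 h3)

/-- **Kill criterion for `SubcriticalTailEnvelope`.**  Fix a spread `R ≥ 1`.  If at arbitrarily small
scale ratios some E₂(R) table, one-shell datum, defect level `K₁ ≥ 0`, window `[0,T]` and `c > 0`
admit, for every shell `n`, a `(K₁,0)`-pseudo-solution on `[0,T]` whose shell-`n` energy reaches the
CRITICAL level `c(1+ε₀)^{-n}` within the window (critical fronts persisting to every shell — e.g. the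
gated fronts of the dyadic member), then `SubcriticalTailEnvelope` is false.  Negative lemma modulo the
existence of such fronts (hypothesis `hF`); pure logic on top of
`not_exists_envelope_const_of_criticalFronts`.
[cite: Tao2016AveragedNS, §4 Lemma 4.1 (4.5)–(4.11), Thm. 4.2 (statement shape); cell vocabulary] -/
theorem subcriticalTailEnvelope_false_of_criticalFronts {R : ℝ} (hR : 1 ≤ R)
    (hF : ∀ ε : ℝ, 0 < ε → ∃ ε₀ : ℝ, 0 < ε₀ ∧ ε₀ ≤ ε ∧
      ∃ α : Fin 4 → Fin 4 → Fin 4 → ℤ × ℤ × ℤ → ℝ, InTableClass R α ∧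
        ∃ (X₀ : Fin 4 → ℝ) (K₁ : ℝ), 0 ≤ K₁ ∧ ∃ T : ℝ, 0 < T ∧ ∃ c : ℝ, 0 < c ∧
          ∀ n : ℕ, ∃ X E : Fin 4 → ℤ → ℝ → ℝ, CascadeODESolutionOn T ε₀ α K₁ 0 0 X₀ X E ∧
            ∃ t ∈ Icc (0 : ℝ) T, c * (1 + ε₀) ^ (-(n : ℝ)) ≤ ∑ i, E i (n : ℤ) t) :
    ¬ Summit.NavierStokesRegularity.NavierStokesRegularity.Theses.SubcriticalEnvelope.SubcriticalTailEnvelope := by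
  intro hA
  obtain ⟨η, εs, hη, hεs, H⟩ := hA R hR
  obtain ⟨ε₀, hε₀, hle, α, hα, X₀, K₁, hK₁, T, hT, c, hc, hfam⟩ := hF εs hεs
  exact not_exists_envelope_const_of_criticalFronts hε₀ hη hc hfam (H ε₀ hε₀ hle α hα X₀ K₁ hK₁ T hT)

/-- **`GatedCriticalFronts` — the construction the negative lemma is modulo.**  Critical fronts of
the DYADIC member `dyadicTable ∈ E₂(2)` among its sub-dissipatively perturbed trajectories, at
arbitrarily small scale ratios: for every `ε > 0` there are a scale ratio `1+ε₀ ≤ 1+ε`, a one-shell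
datum `X₀` at shell `0`, a defect level `K₁ ≥ 0`, a window `[0,T]` and `c > 0` such that for EVERY
shell `n` some `(K₁,0)`-pseudo-solution of the damped Katz–Pavlović / Cheskidov chain
(`ȧ_n = λ^{5(n-1)/2}a_{n-1}² − λ^{5n/2}a_n a_{n+1} − d_n(t)a_n`, `0 ≤ d_n ≤ K₁λ^{2n}/√2`, `λ = 1+ε₀`;
tree: `CascadeODESolutionOn T ε₀ dyadicTable K₁ 0 0 X₀`) has shell-`n` energy at least the CRITICAL
level `c(1+ε₀)^{-n}` at some time of the window.  Numerically realised by GATED damping schedules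
(damp the modes two shells ahead of the front maximally while the current hop completes; evidence
memo on stmt-NavierStokesRegularity-23973: `λ ∈ {1.1, 1.25, 1.5}`, `K₁ ∈ {10, 100}`, critical-normalised
front energies converge to a positive `K₁`-dependent constant).  A `Prop`; NOTHING is asserted — it is
the hypothesis of `subcriticalTailEnvelope_false_of_gatedCriticalFronts`; a construction target, not a published
fact (refs: Tao2016AveragedNS §1.2 (dyadic model), §4 Lemma 4.1 (4.5)–(4.11) for the vocabulary). -/
def GatedCriticalFronts : Prop :=
  ∀ ε : ℝ, 0 < ε → ∃ ε₀ : ℝ, 0 < ε₀ ∧ ε₀ ≤ ε ∧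
    ∃ (X₀ : Fin 4 → ℝ) (K₁ : ℝ), 0 ≤ K₁ ∧ ∃ T : ℝ, 0 < T ∧ ∃ c : ℝ, 0 < c ∧
      ∀ n : ℕ, ∃ X E : Fin 4 → ℤ → ℝ → ℝ, CascadeODESolutionOn T ε₀ dyadicTable K₁ 0 0 X₀ X E ∧
        ∃ t ∈ Icc (0 : ℝ) T, c * (1 + ε₀) ^ (-(n : ℝ)) ≤ ∑ i, E i (n : ℤ) t

/-- **Negative lemma: `GatedCriticalFronts → ¬ SubcriticalTailEnvelope`.**  Critical fronts of the
dyadic member `dyadicTable ∈ E₂(2)` persisting to every shell at arbitrarily small scale ratios refute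
the crux (instance `R = 2` of `subcriticalTailEnvelope_false_of_criticalFronts`).  The item stays open:
this settles nothing until `GatedCriticalFronts` is constructed.
[cite: Tao2016AveragedNS, §1.2 (dyadic model), §4 Lemma 4.1; cell vocabulary] -/
theorem subcriticalTailEnvelope_false_of_gatedCriticalFronts (hF : GatedCriticalFronts) :
    ¬ Summit.NavierStokesRegularity.NavierStokesRegularity.Theses.SubcriticalEnvelope.SubcriticalTailEnvelope := by
  refine subcriticalTailEnvelope_false_of_criticalFronts (R := 2) (by norm_num) fun ε hε => ?_
  obtain ⟨ε₀, hε₀, hle, X₀, K₁, hK₁, T, hT, c, hc, hfam⟩ := hF ε hε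
  exact ⟨ε₀, hε₀, hle, dyadicTable, inTableClass_dyadicTable le_rfl, X₀, K₁, hK₁, T, hT, c, hc, hfam⟩

/-- **The same fronts empty the hypothesis of `EnvelopeSmoothing` (stmt-NavierStokesRegularity-24008).**
At a scale ratio, table and datum carrying critical fronts at some defect level on some window, the
window-wise subcritical-envelope hypothesis of `EnvelopeSmoothing` fails for every margin `η > 0` — so
that crux asserts nothing there (it is vacuously true at such data).
[cite: Tao2016AveragedNS, §4 Lemma 4.1 (4.5)–(4.11); cell vocabulary] -/
theorem envelopeSmoothing_hypothesis_false_of_criticalFronts {ε₀ η : ℝ} (hε₀ : 0 < ε₀) (hη : 0 < η)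
    {α : Fin 4 → Fin 4 → Fin 4 → ℤ × ℤ × ℤ → ℝ} {X₀ : Fin 4 → ℝ}
    (hF : ∃ K₁ : ℝ, 0 ≤ K₁ ∧ ∃ T : ℝ, 0 < T ∧ ∃ c : ℝ, 0 < c ∧
      ∀ n : ℕ, ∃ X E : Fin 4 → ℤ → ℝ → ℝ, CascadeODESolutionOn T ε₀ α K₁ 0 0 X₀ X E ∧
        ∃ t ∈ Icc (0 : ℝ) T, c * (1 + ε₀) ^ (-(n : ℝ)) ≤ ∑ i, E i (n : ℤ) t) :
    ¬ (∀ K₁ : ℝ, 0 ≤ K₁ → ∀ T : ℝ, 0 < T → ∃ C : ℝ, ∀ X E : Fin 4 → ℤ → ℝ → ℝ,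
        CascadeODESolutionOn T ε₀ α K₁ 0 0 X₀ X E → ∀ n N : ℕ, n ≤ N → ∀ t ∈ Icc (0 : ℝ) T,
          ∑ k ∈ Finset.Icc n N, ∑ i, E i (k : ℤ) t ≤ C * (1 + ε₀) ^ (-((1 + η) * (n : ℝ)))) := by
  intro h
  obtain ⟨K₁, hK₁, T, hT, c, hc, hfam⟩ := hF
  exact not_exists_envelope_const_of_criticalFronts hε₀ hη hc hfam (h K₁ hK₁ T hT)

end SubcriticalEnvelopeSubcriticalTailEnvelopeNegative

end Summit.NavierStokesRegularity.NavierStokesRegularity.Theorems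

end
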